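import Summits.HodgeConjecture.CorCM.GaloisCyclicFourCompositum
import Summits.HodgeConjecture.CorCM.AbelianTwoGroupInvolutionLemmas
import HarnessLib

/-!
# (Totally real Galois field of even degree `≥ 6`) · (cyclic quartic CM field) is BAD: equidistributed primitive
# interval families exist

COR-CM (cell `pub-hodgecm2`), binder seat b04 (gen 23), count-neutral claim CYCLIC-BY-MULTIPLIERS, part X (blanket
NAME ACK `CorCM/GaloisCyclicFour*`, HOME/INBOX l.9773).  HC_CM is NOT proved here; unconditional negative-side
examples.

Setting: `Gal(K/ℚ) ≅ H × C₄` with complex conjugation `(1, 2)`, i.e. `K = M · L` with `M` totally real Galois of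
group `H` and `L` a cyclic quartic CM field, linearly disjoint.  A CM type is a LEVEL FUNCTION `ℓ : H → ℤ/4`: the
fibre over `q` is the interval `{ℓ(q), ℓ(q)+1}`.  Part IX's criterion (`exists_simple_degenerate_of_model_fibres`)
makes the type degenerate as soon as every `w ∈ ℤ/4` lies in `|H|/2` fibres, i.e. `N₀ = N₂` and `N₁ = N₃` for the
level counts `N_t = #ℓ⁻¹(t)`; it is primitive iff `ℓ(aq) = ℓ(q) + b` for all `q` forces `(a, b) = (1, 0)`.

THE LEVEL FUNCTION.  `ℓ(1) = 0`, `ℓ(h₁) = 2` for one `h₁` with `h₁² ≠ 1`, and the remaining `|H| − 2` elements split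
evenly between the levels `1` and `3`.  Periods `(a, b)`: `b = ℓ(a)`; `b = 0` gives `a = 1`; `b = 2` gives `a = h₁`
and then `ℓ(h₁²) = 0`, i.e. `h₁² = 1`; `b = ±1` maps the level set `ℓ⁻¹(1)` (of size `|H|/2 − 1 ≥ 2`) into the
singleton `ℓ⁻¹(0)` — impossible.  Hence (`exists_simple_degenerate_of_real_cyclicFour_compositum`):

**if `M` is a totally real Galois field of even degree `≥ 6` whose group has an element of order `> 2`, and `L` is a
cyclic quartic CM field linearly disjoint from `M`, then `K = M·L` carries a SIMPLE DEGENERATE abelian variety of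
dimension `2[M:ℚ]`** (e.g. `M` real cyclic sextic and `L = ℚ(ζ₅)`: `Gal = C₆ × C₄`; `Q₈ × C₄`, `D₄ × C₄`, `A₄ × C₄`,
`S₄ × C₄`, …).  The elementary abelian case `H = C₂ᵏ`, `k ≥ 3`, needs a coset-adapted split and is left open here;
`|H| = 4` is genuinely different (`C₂² × C₄` is GOOD, gen 15).

References: Shimura (1998), §6.2 Thm. 3, §8.2 Prop. 26 [cite: Shimura1998]; Gordon (1999), Thm. 6.4, §9
[cite: Gordon1999HodgeAVSurvey].
-/

noncomputable section

open CategoryTheory CategoryTheory.Limits NumberField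
open scoped BigOperators

namespace Summit.HodgeConjecture.CorCM.GaloisModels

open Literature.NumberTheory.ComplexMultiplication
open Literature.AlgebraicGeometry.Motives (AbelianVariety CMType)
open Literature.AlgebraicGeometry.HodgeTheory
open Literature.AlgebraicGeometry.ComplexMultiplication (IsCMTypeRealisation)
open Literature.AlgebraicGeometry.Pohlmann1968
open Literature.Barriers.HodgeConjecture (divisorClassesSpan)

section Levels

/-- Intervals of length `2` in `ℤ/4` are CM sets for `c = 2`. [folklore] -/
theorem zmod_four_interval_cm : ∀ t w : ZMod 4, (w = t ∨ w = t + 1) ↔ ¬ (2 + w = t ∨ 2 + w = t + 1) := by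
  decide

/-- An interval of length `2` in `ℤ/4` is determined by its starting point. [folklore] -/
theorem zmod_four_interval_start : ∀ s t : ZMod 4, (s = t ∨ s = t + 1) → (s + 1 = t ∨ s + 1 = t + 1) → s = t := by
  decide

/-- `w` lies in the interval starting at `t` iff `t ∈ {w, w − 1}`. [folklore] -/
theorem zmod_four_interval_mem : ∀ t w : ZMod 4, (w = t ∨ w = t + 1) ↔ (t = w ∨ t = w + 3) := by
  decide

variable {H : Type*} [Group H] [Fintype H] [DecidableEq H]
variable {K : Type} [Field K] [NumberField K] [IsCMField K] [IsGalois ℚ K]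

/-- **Level functions give simple degenerate CM types.**  `Gal(K/ℚ) ≅ H × C₄`, `c = (1, 2)`; a level function
`ℓ : H → ℤ/4` with `ℓ⁻¹(0) = {1}`, `ℓ⁻¹(2) = {h₁}` (`h₁² ≠ 1`), `#ℓ⁻¹(1) ≥ 2` and every `w` in exactly `|H|/2` of
the intervals `{ℓ(q), ℓ(q)+1}` yields a SIMPLE DEGENERATE abelian variety of dimension `2|H|` with CM by `K`.
[cite: Shimura1998, §6.2 Thm. 3 and §8.2 Prop. 26] [cite: Gordon1999HodgeAVSurvey, Thm. 6.4 and §9.3] -/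
theorem exists_simple_degenerate_of_real_cyclicFour_levels (e : (K ≃ₐ[ℚ] K) ≃* H × Multiplicative (ZMod 4))
    (hc : e ((IsCMField.complexConj K).restrictScalars ℚ) = (1, Multiplicative.ofAdd 2)) (ℓ : H → ZMod 4)
    (h₁ : H) (hh : h₁ * h₁ ≠ 1) (h0 : ∀ q, ℓ q = 0 ↔ q = 1) (h2 : ∀ q, ℓ q = 2 ↔ q = h₁)
    (hbig : 2 ≤ (Finset.univ.filter fun q => ℓ q = 1).card)
    (hfib : ∀ w : ZMod 4, 2 * (Finset.univ.filter fun q => ℓ q = w ∨ ℓ q = w + 3).card = Fintype.card H) :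
    ∃ (Φ : CMType K) (φ₀ : K →+* ℂ) (A : AbelianVariety ℂ) (ι : 𝓞 K →+* End A)
      (θ : K →+* Module.End ℂ (complexBetti A.X 1)),
      IsPrimitive (ℂ ≃+* ℂ) Φ.1 φ₀ ∧ ¬ IsNondegenerate Φ ∧ IsCMTypeRealisation Φ A ι θ ∧ A.IsSimple ∧
      A.dim = 2 * Fintype.card H ∧
      ∃ n p : ℕ, ∃ x : complexBetti (⨁ fun _ : Fin n => A).X (2 * p), IsRationalClass x ∧
        IsOfHodgeType (⨁ fun _ : Fin n => A).dim (⨁ fun _ : Fin n => A).X (2 * p) p p x ∧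
        x ∉ divisorClassesSpan (⨁ fun _ : Fin n => A).X (⨁ fun _ : Fin n => A).dim p := by
  classical
  have hmem : ∀ (q : H) (v : Multiplicative (ZMod 4)),
      v ∈ (Finset.univ.filter fun v : Multiplicative (ZMod 4) =>
        Multiplicative.toAdd v = ℓ q ∨ Multiplicative.toAdd v = ℓ q + 1) ↔
      (Multiplicative.toAdd v = ℓ q ∨ Multiplicative.toAdd v = ℓ q + 1) := fun q v => by
    simp only [Finset.mem_filter, Finset.mem_univ, true_and]
  have hmain := exists_simple_degenerate_of_model_fibres e 1 (Multiplicative.ofAdd (2 : ZMod 4)) hc (by decide)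
    (fun q => Finset.univ.filter fun v : Multiplicative (ZMod 4) =>
      Multiplicative.toAdd v = ℓ q ∨ Multiplicative.toAdd v = ℓ q + 1)
    (fun q v => by
      rw [hmem, hmem, one_mul, toAdd_mul, toAdd_ofAdd]
      exact zmod_four_interval_cm (ℓ q) (Multiplicative.toAdd v))
    (by
      rintro ⟨a, b⟩ hy
      by_contra hcon
      push Not at hcon
      have key : ∀ q, Multiplicative.toAdd b + ℓ q = ℓ (a * q) := by
        intro q
        have m1 := (hcon q (Multiplicative.ofAdd (ℓ q))).1
          (by rw [hmem, toAdd_ofAdd]; exact Or.inl rfl)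
        have m2 := (hcon q (Multiplicative.ofAdd (ℓ q + 1))).1
          (by rw [hmem, toAdd_ofAdd]; exact Or.inr rfl)
        rw [hmem, toAdd_mul, toAdd_ofAdd] at m1 m2
        rw [← add_assoc] at m2
        exact zmod_four_interval_start _ _ m1 m2
      have key1 : ℓ a = Multiplicative.toAdd b := by
        rw [← mul_one a, ← key 1, (h0 1).2 rfl, add_zero]
      rcases TwoGroupPieces.zmod_four_cases (Multiplicative.toAdd b) with hb | hb | hb | hb
      · -- `b = 0`: `ℓ a = 0`, so `a = 1`
        rw [hb, h0] at key1
        apply hy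
        rw [key1, show b = 1 from by rw [← ofAdd_toAdd b, hb]; rfl]
        rfl
      · -- `b = 1`: the level set `ℓ⁻¹(1)` is mapped by `a⁻¹` into `ℓ⁻¹(0) = {1}`
        have hS : (Finset.univ.filter fun q => ℓ q = 1) ⊆ {a} := by
          intro q hq
          rw [Finset.mem_filter] at hq
          have hk := key (a⁻¹ * q)
          rw [mul_inv_cancel_left, hq.2, hb] at hk
          have h' : ℓ (a⁻¹ * q) = 0 := by linear_combination hk
          rw [h0] at h'
          rw [Finset.mem_singleton, ← mul_inv_cancel_left a q, h', mul_one]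
        have := Finset.card_le_card hS
        rw [Finset.card_singleton] at this
        omega
      · -- `b = 2`: `a = h₁`, then `ℓ (h₁ h₁) = 0`, i.e. `h₁² = 1`
        rw [hb, h2] at key1
        have hk := key h₁
        rw [key1, hb, (h2 h₁).2 rfl, show (2 : ZMod 4) + 2 = 0 from by decide] at hk
        exact hh ((h0 _).1 hk.symm)
      · -- `b = 3`: the level set `ℓ⁻¹(1)` is mapped by `a` into `ℓ⁻¹(0) = {1}`
        have hS : (Finset.univ.filter fun q => ℓ q = 1) ⊆ {a⁻¹} := by
          intro q hq
          rw [Finset.mem_filter] at hq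
          have hk := key q
          rw [hq.2, hb, show (3 : ZMod 4) + 1 = 0 from by decide] at hk
          have h' := (h0 _).1 hk.symm
          rw [Finset.mem_singleton, ← inv_mul_cancel_left a q, h', mul_one]
        have := Finset.card_le_card hS
        rw [Finset.card_singleton] at this
        omega)
    (fun v => by
      rw [← hfib (Multiplicative.toAdd v)]
      congr 2
      ext q
      simp only [Finset.mem_filter, Finset.mem_univ, true_and]
      exact zmod_four_interval_mem (ℓ q) (Multiplicative.toAdd v))
  rwa [Fintype.card_multiplicative, ZMod.card,
    show Fintype.card H * 4 / 2 = 2 * Fintype.card H by omega] at hmain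

/-- **(Totally real Galois `M` of even degree `≥ 6` with an element of order `> 2` in its group) · (cyclic quartic CM
field) is BAD**: `Gal(K/ℚ) ≅ H × C₄`, `c = (1, 2)`, `|H| ≥ 6` even, `h₁² ≠ 1` for some `h₁ ∈ H` ⟹ a SIMPLE
DEGENERATE abelian variety of dimension `2|H|` with CM by `K` (level function `ℓ(1) = 0`, `ℓ(h₁) = 2`, the rest
split evenly between `1` and `3`). [cite: Shimura1998, §6.2 Thm. 3 and §8.2 Prop. 26]
[cite: Gordon1999HodgeAVSurvey, Thm. 6.4 and §9.3] -/
theorem exists_simple_degenerate_of_real_cyclicFour_compositum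
    (e : (K ≃ₐ[ℚ] K) ≃* H × Multiplicative (ZMod 4))
    (hc : e ((IsCMField.complexConj K).restrictScalars ℚ) = (1, Multiplicative.ofAdd 2))
    (heven : Even (Fintype.card H)) (h6 : 6 ≤ Fintype.card H) (h₁ : H) (hh : h₁ * h₁ ≠ 1) :
    ∃ (Φ : CMType K) (φ₀ : K →+* ℂ) (A : AbelianVariety ℂ) (ι : 𝓞 K →+* End A)
      (θ : K →+* Module.End ℂ (complexBetti A.X 1)),
      IsPrimitive (ℂ ≃+* ℂ) Φ.1 φ₀ ∧ ¬ IsNondegenerate Φ ∧ IsCMTypeRealisation Φ A ι θ ∧ A.IsSimple ∧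
      A.dim = 2 * Fintype.card H ∧
      ∃ n p : ℕ, ∃ x : complexBetti (⨁ fun _ : Fin n => A).X (2 * p), IsRationalClass x ∧
        IsOfHodgeType (⨁ fun _ : Fin n => A).dim (⨁ fun _ : Fin n => A).X (2 * p) p p x ∧
        x ∉ divisorClassesSpan (⨁ fun _ : Fin n => A).X (⨁ fun _ : Fin n => A).dim p := by
  classical
  have h1ne : h₁ ≠ 1 := fun h => hh (by rw [h, mul_one])
  obtain ⟨m, hm⟩ := heven
  have hS₀ : (Finset.univ \ {1, h₁} : Finset H).card = Fintype.card H - 2 := by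
    rw [Finset.card_sdiff_of_subset (Finset.subset_univ _), Finset.card_univ, Finset.card_pair (Ne.symm h1ne)]
  obtain ⟨S, hSsub, hScard⟩ := Finset.exists_subset_card_eq
    (s := (Finset.univ \ {1, h₁} : Finset H)) (n := m - 1) (by omega)
  have h1S : (1 : H) ∉ S := fun h => by simpa using hSsub h
  have hhS : h₁ ∉ S := fun h => by simpa using hSsub h
  let ℓ : H → ZMod 4 := fun q => if q = 1 then 0 else if q = h₁ then 2 else if q ∈ S then 1 else 3
  -- the value of `ℓ` in the four regions
  have hval : ∀ q, (q = 1 ∧ ℓ q = 0) ∨ (q = h₁ ∧ ℓ q = 2) ∨ (q ∈ S ∧ ℓ q = 1) ∨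
      (q ≠ 1 ∧ q ≠ h₁ ∧ q ∉ S ∧ ℓ q = 3) := fun q => by
    by_cases hq1 : q = 1
    · exact Or.inl ⟨hq1, by simp [ℓ, hq1]⟩
    by_cases hq2 : q = h₁
    · exact Or.inr (Or.inl ⟨hq2, by simp [ℓ, hq2, h1ne]⟩)
    by_cases hq3 : q ∈ S
    · exact Or.inr (Or.inr (Or.inl ⟨hq3, by simp [ℓ, hq1, hq2, hq3]⟩))
    · exact Or.inr (Or.inr (Or.inr ⟨hq1, hq2, hq3, by simp [ℓ, hq1, hq2, hq3]⟩))
  have hn1 : ¬ ((1 : H) = h₁ ∨ (1 : H) ∈ S) := fun h => h.elim (Ne.symm h1ne) h1S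
  have hnh : ¬ (h₁ = 1 ∨ h₁ ∈ S) := fun h => h.elim h1ne hhS
  -- level sets
  have hL1 : (Finset.univ.filter fun q => ℓ q = 1) = S := by
    ext q
    simp only [Finset.mem_filter, Finset.mem_univ, true_and]
    rcases hval q with ⟨h, hl⟩ | ⟨h, hl⟩ | ⟨h, hl⟩ | ⟨-, -, h'', hl⟩ <;> rw [hl]
    · rw [h]; exact ⟨fun h' => absurd h' (by decide), fun h' => absurd h' h1S⟩
    · rw [h]; exact ⟨fun h' => absurd h' (by decide), fun h' => absurd h' hhS⟩
    · exact ⟨fun _ => h, fun _ => rfl⟩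
    · exact ⟨fun h' => absurd h' (by decide), fun h' => absurd h' h''⟩
  have hA : (Finset.univ.filter fun q => ℓ q = 1 ∨ ℓ q = 0) = insert 1 S := by
    ext q
    simp only [Finset.mem_filter, Finset.mem_univ, true_and, Finset.mem_insert]
    rcases hval q with ⟨h, hl⟩ | ⟨h, hl⟩ | ⟨h, hl⟩ | ⟨h, -, h'', hl⟩ <;> rw [hl]
    · rw [h]; exact ⟨fun _ => Or.inl rfl, fun _ => by decide⟩
    · rw [h]; exact ⟨fun h' => absurd h' (by decide), fun h' => absurd h' hnh⟩
    · exact ⟨fun _ => Or.inr h, fun _ => by decide⟩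
    · exact ⟨fun h' => absurd h' (by decide), fun h' => absurd h' (fun h₀ => h₀.elim h h'')⟩
  have hB : (Finset.univ.filter fun q => ℓ q = 2 ∨ ℓ q = 1) = insert h₁ S := by
    ext q
    simp only [Finset.mem_filter, Finset.mem_univ, true_and, Finset.mem_insert]
    rcases hval q with ⟨h, hl⟩ | ⟨h, hl⟩ | ⟨h, hl⟩ | ⟨-, h', h'', hl⟩ <;> rw [hl]
    · rw [h]; exact ⟨fun h' => absurd h' (by decide), fun h' => absurd h' hn1⟩
    · rw [h]; exact ⟨fun _ => Or.inl rfl, fun _ => by decide⟩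
    · exact ⟨fun _ => Or.inr h, fun _ => by decide⟩
    · exact ⟨fun h₀ => absurd h₀ (by decide), fun h₀ => absurd h₀ (fun h₀ => h₀.elim h' h'')⟩
  have hC : (Finset.univ.filter fun q => ℓ q = 0 ∨ ℓ q = 3) = Finset.univ \ insert h₁ S := by
    ext q
    simp only [Finset.mem_filter, Finset.mem_univ, true_and, Finset.mem_sdiff, Finset.mem_insert]
    rcases hval q with ⟨h, hl⟩ | ⟨h, hl⟩ | ⟨h, hl⟩ | ⟨-, h', h'', hl⟩ <;> rw [hl]
    · rw [h]; exact ⟨fun _ => hn1, fun _ => by decide⟩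
    · rw [h]; exact ⟨fun h' => absurd h' (by decide), fun h' => absurd (Or.inl rfl) h'⟩
    · exact ⟨fun h' => absurd h' (by decide), fun h' => absurd (Or.inr h) h'⟩
    · exact ⟨fun _ => fun h₀ => h₀.elim h' h'', fun _ => by decide⟩
  have hD : (Finset.univ.filter fun q => ℓ q = 3 ∨ ℓ q = 2) = Finset.univ \ insert 1 S := by
    ext q
    simp only [Finset.mem_filter, Finset.mem_univ, true_and, Finset.mem_sdiff, Finset.mem_insert]
    rcases hval q with ⟨h, hl⟩ | ⟨h, hl⟩ | ⟨h, hl⟩ | ⟨h, -, h'', hl⟩ <;> rw [hl]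
    · rw [h]; exact ⟨fun h' => absurd h' (by decide), fun h' => absurd (Or.inl rfl) h'⟩
    · rw [h]; exact ⟨fun _ => hnh, fun _ => by decide⟩
    · exact ⟨fun h' => absurd h' (by decide), fun h' => absurd (Or.inr h) h'⟩
    · exact ⟨fun _ => fun h₀ => h₀.elim h h'', fun _ => by decide⟩
  have hcard1 : (insert (1 : H) S).card = m := by rw [Finset.card_insert_of_notMem h1S]; omega
  have hcardh : (insert h₁ S).card = m := by rw [Finset.card_insert_of_notMem hhS]; omega
  refine exists_simple_degenerate_of_real_cyclicFour_levels e hc ℓ h₁ hh ?_ ?_ ?_ ?_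
  · intro q
    rcases hval q with ⟨h, hl⟩ | ⟨h, hl⟩ | ⟨h, hl⟩ | ⟨h, -, -, hl⟩ <;> rw [hl]
    · exact ⟨fun _ => h, fun _ => rfl⟩
    · rw [h]; exact ⟨fun h' => absurd h' (by decide), fun h' => absurd h' h1ne⟩
    · exact ⟨fun h' => absurd h' (by decide), fun h' => absurd h' (fun h₀ => h1S (h₀ ▸ h))⟩
    · exact ⟨fun h' => absurd h' (by decide), fun h' => absurd h' h⟩
  · intro q
    rcases hval q with ⟨h, hl⟩ | ⟨h, hl⟩ | ⟨h, hl⟩ | ⟨-, h', -, hl⟩ <;> rw [hl]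
    · rw [h]; exact ⟨fun h' => absurd h' (by decide), fun h' => absurd h' (Ne.symm h1ne)⟩
    · exact ⟨fun _ => h, fun _ => rfl⟩
    · exact ⟨fun h' => absurd h' (by decide), fun h' => absurd h' (fun h₀ => hhS (h₀ ▸ h))⟩
    · exact ⟨fun h₀ => absurd h₀ (by decide), fun h₀ => absurd h₀ h'⟩
  · rw [hL1]
    omega
  · intro w
    rcases TwoGroupPieces.zmod_four_cases w with rfl | rfl | rfl | rfl
    · rw [show (0 : ZMod 4) + 3 = 3 from by decide, hC, Finset.card_sdiff_of_subset (Finset.subset_univ _),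
        Finset.card_univ, hcardh]
      omega
    · rw [show (1 : ZMod 4) + 3 = 0 from by decide, hA, hcard1]
      omega
    · rw [show (2 : ZMod 4) + 3 = 1 from by decide, hB, hcardh]
      omega
    · rw [show (3 : ZMod 4) + 3 = 2 from by decide, hD, Finset.card_sdiff_of_subset (Finset.subset_univ _),
        Finset.card_univ, hcard1]
      omega

end Levels

end Summit.HodgeConjecture.CorCM.GaloisModels
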